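import Summits.ValiantsHypothesis.ValiantsHypothesis.Theorems.TwistedDetRankSliceVBPFermionicReturnGadget
import Literature.Computability.AlgebraicComplexity.SymmetricCircuitSubstitution
import Literature.Computability.AlgebraicComplexity.SymmetricCircuitPullback
import Literature.Computability.AlgebraicComplexity.SymmetricCircuitConstOutputs
import Literature.Computability.AlgebraicComplexity.SymmetricCircuitPairing
import Literature.Computability.AlgebraicComplexity.SymmetricCircuitHadamard
import Literature.Computability.AlgebraicComplexity.SymmetricCircuitScaledInputs

/-!
# Crux `TwistedDetRank.SliceVBPFermionic` (stmt-ValiantsHypothesis-17991, X2b) — the return gadget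
# at the level of SYMMETRIC CIRCUITS

Third seat on the item (val-width-17991-p1 g2), part 1 of 2 (part 2:
Theorems/TwistedDetRankSliceVBPFermionicSymmetricTransfer.lean).  The registered line of X2b is
`stub_restorationVBP → stub_symmetricFermionic` (Cruxes/FermionicNormalForm/SplitVBPSkeletonX2b.lean);
its second stub — and the route's banked residue `Theses.TwistedDetRank.SymA` (stmt-21368) — have the
common HYPOTHESIS "the GMFs `f_n = Σ_σ χ_n(σ) X^σ` of `χ` are computed by `S_n`-symmetric
(square-symmetric, Dawar–Wilsenach) circuits of size `≤ 2^((log₂ n + c)^c)` for every `n`".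
The first seat moved the RETURN GADGET `X ↦ (0 Y; J 0)` through `dc`
(Theorems/…ReturnGadget.lean: `f_{2a}(0 Y; J 0) = c_a(χ) · per_a`, `c_a` the doubling sum) and
through `tdr` (Theorems/…TdrTransfer.lean).  This file moves it through SYMMETRIC CIRCUITS, with the
tree's symmetric-circuit toolbox (`SymmetricCircuit{ScaledInputs,ConstOutputs,Pairing,Pullback,
Substitution,Hadamard}.lean`, all proved closure properties of Dawar–Wilsenach Def. 2.2/3.6/3.7):

* §1  The doubling embedding `S_a ↪ S_{a+a}`, `ρ ↦ ρ ⊔ ρ` along `finSumFinEquiv` (`dupPerm`,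
  `dupPermHom`), the RESTRICTED diagonal action of `S_a` on the doubled variable matrix
  (`dupAction`, used as a local instance only), and restriction of symmetry along it
  (`isSymmetric_dup`: an `S_{a+a}`-symmetric circuit is `S_a`-symmetric).
* §2  An `S_a`-symmetric circuit on `≤ 7 (a+a)^2 + 1` gates whose output family, indexed by the
  doubled matrix, is the return substitution `(0 Y; Z 0)` of the first seat (`retSubstFin Z`) for any
  diagonally invariant return block `Z` (`exists_symmetric_retSubstFin`; the variable/constant pattern
  is `retIndex` / `retConst`, equivariant resp. invariant: `retIndex_smul`, `retConst_smul`).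
* §3  TRANSPORT (`exists_symmetric_aeval_retSubstFin`): a square-symmetric circuit for `f` on the
  `(a+a) × (a+a)` matrix gives a square-symmetric circuit for `f(0 Y; Z 0)` on the `a × a` matrix
  with `≤ 7 (a+a)^2 + 1` more gates; for a CLASS FUNCTION `χ` with `c_a(χ) ≠ 0` and `Z = J`, one
  for `per_a` with `≤ 7 (a+a)^2 + 4` more gates (`exists_symmetric_perPoly_of_gmf`; the constant
  `c_a(χ)⁻¹` enters by a Hadamard product with an invariant constant output).

Part 2 feeds the transported permanent family to the PROVED Dawar–Wilsenach Theorem 7.1.  Nothing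
here proves or refutes X2b (≥ `VNP ⊄ VBP`) or SymA; `VP ≠ VNP` is not moved by this item alone.

References: A. Dawar, G. Wilsenach, *Symmetric Arithmetic Circuits*, Theory of Computing 21 (2025),
Def. 2.2/3.6/3.7 (the circuit model, as rendered in `SymmetricArithCircuit.lean`), remark after
Def. 3.7 (closure properties); L. G. Valiant, STOC 1979 (projections).  The `def`s below (`dupPerm`,
`dupPermHom`, `dupAction`, `retIndex`, `retConst`) are proof gadgets naming the embedding and the
substitution pattern, not route objects (cf. `retSubst`, `doublingSum` of the first seat).
-/

-- single-conjunct layout: Sub = Summit, duplicated namespace component intended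
set_option linter.dupNamespace false

noncomputable section

namespace Summit.ValiantsHypothesis.ValiantsHypothesis.Theorems.TwistedDetRankSliceVBPFermionic

open Equiv MvPolynomial Literature.Computability.AlgebraicComplexity
open Summit.ValiantsHypothesis.ValiantsHypothesis.Theorems.TwistedDetRankFermionicNormalForm
open scoped BigOperators

/-! ## §1 The doubling embedding `S_a → S_{a+a}`, `ρ ↦ ρ ⊔ ρ` -/

section Doubling

variable {a : ℕ}

/-- The DOUBLED permutation `ρ ⊔ ρ` of `Fin (a + a)` (blocks along `finSumFinEquiv`): `ρ` acting on
both copies of `Fin a`. [folklore] -/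
def dupPerm (ρ : Perm (Fin a)) : Perm (Fin (a + a)) :=
  finSumFinEquiv.permCongr (ρ.sumCongr ρ)

/-- `ρ ⊔ ρ` on a point of the doubled index set, read through `finSumFinEquiv`. [folklore] -/
theorem dupPerm_apply_finSumFinEquiv (ρ : Perm (Fin a)) (s : Fin a ⊕ Fin a) :
    dupPerm ρ (finSumFinEquiv s) = finSumFinEquiv (Sum.map ρ ρ s) := by
  simp [dupPerm, Equiv.permCongr_apply]

/-- `ρ ⊔ ρ` read back through `finSumFinEquiv.symm`. [folklore] -/
theorem finSumFinEquiv_symm_dupPerm (ρ : Perm (Fin a)) (x : Fin (a + a)) :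
    finSumFinEquiv.symm (dupPerm ρ x) = Sum.map ρ ρ (finSumFinEquiv.symm x) := by
  obtain ⟨s, rfl⟩ := finSumFinEquiv.surjective x
  rw [dupPerm_apply_finSumFinEquiv, Equiv.symm_apply_apply, Equiv.symm_apply_apply]

/-- The doubling embedding is a group homomorphism `S_a → S_{a+a}`. [folklore] -/
def dupPermHom : Perm (Fin a) →* Perm (Fin (a + a)) where
  toFun := dupPerm
  map_one' := by
    ext x
    obtain ⟨s, rfl⟩ := finSumFinEquiv.surjective x
    rw [dupPerm_apply_finSumFinEquiv]
    cases s <;> rfl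
  map_mul' ρ τ := by
    ext x
    obtain ⟨s, rfl⟩ := finSumFinEquiv.surjective x
    rw [Perm.mul_apply, dupPerm_apply_finSumFinEquiv, dupPerm_apply_finSumFinEquiv,
      dupPerm_apply_finSumFinEquiv]
    cases s <;> rfl

/-- The doubling homomorphism is `dupPerm`. [folklore] -/
@[simp] theorem dupPermHom_apply (ρ : Perm (Fin a)) : dupPermHom ρ = dupPerm ρ := rfl

/-- The RESTRICTED diagonal action of `S_a` on the doubled variable matrix `Fin (a+a) × Fin (a+a)`:
`ρ` acts as `ρ ⊔ ρ` on rows and columns simultaneously. (A local instance: the ambient diagonal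
action of `S_{a+a}` composed with the doubling embedding.) [folklore] -/
@[reducible] def dupAction : MulAction (Perm (Fin a)) (Fin (a + a) × Fin (a + a)) :=
  MulAction.compHom _ dupPermHom

attribute [local instance] dupAction

/-- The restricted action, unfolded: `ρ • (r, c) = (ρ̂ r, ρ̂ c)` with `ρ̂ = ρ ⊔ ρ`. [folklore] -/
theorem dup_smul_def (ρ : Perm (Fin a)) (rc : Fin (a + a) × Fin (a + a)) :
    ρ • rc = (dupPerm ρ rc.1, dupPerm ρ rc.2) := rfl

/-- **Restriction of symmetry along the doubling embedding.** A circuit on the doubled variable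
matrix that is symmetric under the diagonal action of `S_{a+a}` is symmetric under the restricted
diagonal action of `S_a` (same automorphisms, fewer group elements). [folklore] -/
theorem isSymmetric_dup {G : Type*} {C : LabelledArithCircuit ℂ (Fin (a + a) × Fin (a + a)) Unit G}
    (h : C.IsSymmetric (Perm (Fin (a + a)))) : C.IsSymmetric (Perm (Fin a)) := by
  intro ρ
  obtain ⟨π, hπ⟩ := h (dupPerm ρ)
  refine ⟨π, ⟨hπ.children_apply, fun g => ?_, fun y => hπ.output_smul y⟩⟩
  rw [hπ.label_apply]
  cases C.label g <;> rfl

/-! ## §2 The return substitution `(0 Y; Z 0)` is computed by an `S_a`-symmetric circuit -/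

/-- Index map of the return substitution: the entry `(r, c)` of the doubled matrix with `r` in the
first and `c` in the second copy reads the VARIABLE `y_{(r,c)}` (left summand); every other entry
reads a CONSTANT (right summand, indexed by itself). A proof gadget. [folklore] -/
def retIndex (rc : Fin (a + a) × Fin (a + a)) : (Fin a × Fin a) ⊕ (Fin (a + a) × Fin (a + a)) :=
  Sum.elim (fun r => Sum.elim (fun _ => Sum.inr rc) (fun c => Sum.inl (r, c)) (finSumFinEquiv.symm rc.2))
    (fun _ => Sum.inr rc) (finSumFinEquiv.symm rc.1)

/-- Constant part of the return substitution with return block `Z`: `Z r c` on the block (second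
copy, first copy), `0` elsewhere. A proof gadget. [folklore] -/
def retConst (Z : Matrix (Fin a) (Fin a) ℂ) (rc : Fin (a + a) × Fin (a + a)) : ℂ :=
  Sum.elim (fun _ => 0) (fun r => Sum.elim (fun c => Z r c) (fun _ => 0) (finSumFinEquiv.symm rc.2))
    (finSumFinEquiv.symm rc.1)

/-- The return substitution, entry by entry, is the variable / constant selected by `retIndex`,
`retConst`. [folklore] -/
theorem retSubstFin_eq_elim (Z : Matrix (Fin a) (Fin a) ℂ) (rc : Fin (a + a) × Fin (a + a)) :
    retSubstFin Z rc =
      Sum.elim (fun x => (X x : MvPolynomial (Fin a × Fin a) ℂ)) (fun rc' => C (retConst Z rc'))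
        (retIndex rc) := by
  unfold retSubstFin retIndex retConst
  cases h1 : finSumFinEquiv.symm rc.1 <;> cases h2 : finSumFinEquiv.symm rc.2 <;>
    simp [retSubst, h1, h2]

/-- `retIndex` is equivariant for the restricted diagonal action of `S_a` (variables `y_{(r,c)}` go
to `y_{(ρ r, ρ c)}`, the doubled matrix entry `(r, c)` to `(ρ̂ r, ρ̂ c)`). [folklore] -/
theorem retIndex_smul (ρ : Perm (Fin a)) (rc : Fin (a + a) × Fin (a + a)) :
    retIndex (ρ • rc) = ρ • retIndex rc := by
  simp only [retIndex, dup_smul_def, finSumFinEquiv_symm_dupPerm]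
  cases finSumFinEquiv.symm rc.1 <;> cases finSumFinEquiv.symm rc.2 <;>
    simp [dup_smul_def, Equiv.Perm.smul_def]

/-- `retConst Z` is invariant for the restricted diagonal action of `S_a` as soon as the return
block is diagonally invariant (`Z (ρ r) (ρ c) = Z r c`; e.g. `Z = J`, `Z = 1`). [folklore] -/
theorem retConst_smul (Z : Matrix (Fin a) (Fin a) ℂ) (hZ : ∀ (ρ : Perm (Fin a)) r c, Z (ρ r) (ρ c) = Z r c)
    (ρ : Perm (Fin a)) (rc : Fin (a + a) × Fin (a + a)) :
    retConst Z (ρ • rc) = retConst Z rc := by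
  simp only [retConst, dup_smul_def, finSumFinEquiv_symm_dupPerm]
  cases finSumFinEquiv.symm rc.1 <;> cases finSumFinEquiv.symm rc.2 <;>
    simp [hZ]

/-- **The return substitution is symmetrically computable.** For a diagonally invariant return block
`Z` there is an `S_a`-symmetric circuit over the variables `y` (`Fin a × Fin a`, diagonal action)
whose output family, indexed by the doubled matrix `Fin (a+a) × Fin (a+a)` with the restricted
diagonal action, is the return substitution `(0 Y; Z 0)`; it has at most `7 (a+a)^2 + 1` gates.
(Scaled inputs, an invariant constant family, pairing and an equivariant pull-back — all from the
tree's symmetric-circuit toolbox.) [folklore] -/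
theorem exists_symmetric_retSubstFin (Z : Matrix (Fin a) (Fin a) ℂ)
    (hZ : ∀ (ρ : Perm (Fin a)) r c, Z (ρ r) (ρ c) = Z r c) :
    ∃ (G : Type) (_ : Fintype G)
      (C : LabelledArithCircuit ℂ (Fin a × Fin a) (Fin (a + a) × Fin (a + a)) G),
      C.IsSymmetric (Perm (Fin a)) ∧ (∀ rc, C.eval (C.output rc) = retSubstFin Z rc) ∧
      Fintype.card G ≤ 7 * (a + a) ^ 2 + 1 := by
  classical
  -- the variables, each at its own output
  obtain ⟨G₁, _, C₁, h₁s, h₁e, h₁c⟩ :=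
    LabelledArithCircuit.exists_scaledInputs (K := ℂ) (X := Fin a × Fin a) (Perm (Fin a)) (1 : ℂ)
  -- the constants of the substitution, as an invariant family indexed by the doubled matrix
  obtain ⟨G₂, _, C₂, h₂s, h₂e, h₂c⟩ :=
    LabelledArithCircuit.exists_constOutputs (K := ℂ) (Fin a × Fin a) (Γ := Perm (Fin a))
      (retConst Z) (retConst_smul Z hZ)
  obtain ⟨G₃, _, C₃, h₃s, h₃l, h₃r, h₃c⟩ := LabelledArithCircuit.IsSymmetric.exists_pairing h₁s h₂s
  obtain ⟨G₄, _, C₄, h₄s, h₄e, h₄c⟩ :=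
    LabelledArithCircuit.IsSymmetric.exists_pullback h₃s retIndex retIndex_smul
  refine ⟨G₄, inferInstance, C₄, h₄s, fun rc => ?_, ?_⟩
  · rw [h₄e, retSubstFin_eq_elim]
    cases hri : retIndex rc with
    | inl x => rw [Sum.elim_inl, h₃l, h₁e, C_1, one_mul]
    | inr rc' => rw [Sum.elim_inr, h₃r, h₂e]
  · have hX : Fintype.card (Fin a × Fin a) = a * a := by simp
    have hX' : Fintype.card (Fin (a + a) × Fin (a + a)) = (a + a) * (a + a) := by simp
    rw [hX] at h₁c
    rw [hX'] at h₂c h₄c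
    nlinarith [h₁c, h₂c, h₃c, h₄c]

/-! ## §3 Transport of symmetric circuits through the return gadget -/

/-- **The return gadget at the circuit level.** If `f` on the doubled `(a+a) × (a+a)` variable matrix
is computed by a square-symmetric circuit (`S_{a+a}` diagonal), then `f(0 Y; Z 0)` — `Z` a diagonally
invariant return block — is computed by a square-symmetric circuit on the `a × a` matrix `Y`
(`S_a` diagonal) with at most `7 (a+a)^2 + 1` more gates: restrict the symmetry to `S_a ↪ S_{a+a}`,
`ρ ↦ ρ ⊔ ρ`, and substitute the (equivariant) return family (`exists_substitution`). [folklore] -/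
theorem exists_symmetric_aeval_retSubstFin (Z : Matrix (Fin a) (Fin a) ℂ)
    (hZ : ∀ (ρ : Perm (Fin a)) r c, Z (ρ r) (ρ c) = Z r c) {G : Type} [Fintype G]
    {C : LabelledArithCircuit ℂ (Fin (a + a) × Fin (a + a)) Unit G}
    (hC : C.IsSymmetric (Perm (Fin (a + a)))) :
    ∃ (G' : Type) (_ : Fintype G') (C' : LabelledArithCircuit ℂ (Fin a × Fin a) Unit G'),
      C'.IsSymmetric (Perm (Fin a)) ∧
      C'.eval (C'.output ()) = aeval (retSubstFin Z) (C.eval (C.output ())) ∧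
      Fintype.card G' ≤ Fintype.card G + (7 * (a + a) ^ 2 + 1) := by
  obtain ⟨G₁, _, C₁, h₁s, h₁e, h₁c⟩ := exists_symmetric_retSubstFin Z hZ
  obtain ⟨G', _, C', h's, h'e, h'c⟩ :=
    LabelledArithCircuit.IsSymmetric.exists_substitution h₁s (isSymmetric_dup hC)
  refine ⟨G', inferInstance, C', h's, ?_, by omega⟩
  rw [h'e]
  have hfun : (fun x' => C₁.eval (C₁.output x')) = retSubstFin Z := funext h₁e
  rw [hfun]

/-- The all-ones return block is diagonally invariant. -/
theorem ones_invariant (ρ : Perm (Fin a)) (r c : Fin a) :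
    (Matrix.of fun _ _ => (1 : ℂ) : Matrix (Fin a) (Fin a) ℂ) (ρ r) (ρ c) =
      (Matrix.of fun _ _ => (1 : ℂ) : Matrix (Fin a) (Fin a) ℂ) r c := rfl

/-- **From a symmetric circuit for a class-function GMF on `S_{a+a}` to one for `per_a`.** For a class
function `χ` with non-zero doubling sum `c_a(χ)`, a square-symmetric circuit computing its GMF on the
doubled matrix yields a square-symmetric circuit computing `per_a` with at most `7 (a+a)^2 + 4` more
gates: the `J`-gadget gives `c_a(χ) · per_a` (`aeval_retSubstFin_ones_gmf`), and the constant
`c_a(χ)⁻¹` is multiplied in symmetrically (invariant constant, pairing, Hadamard product). [folklore] -/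
theorem exists_symmetric_perPoly_of_gmf (χ : Perm (Fin (a + a)) → ℂ)
    (hχ : ∀ σ τ : Perm (Fin (a + a)), χ (τ * σ * τ⁻¹) = χ σ) (hd : doublingSum χ ≠ 0)
    {G : Type} [Fintype G] {C : LabelledArithCircuit ℂ (Fin (a + a) × Fin (a + a)) Unit G}
    (hC : C.IsSymmetric (Perm (Fin (a + a))))
    (he : C.eval (C.output ()) = ∑ σ : Perm (Fin (a + a)), MvPolynomial.C (χ σ) *
        ∏ i, (X (σ i, i) : MvPolynomial (Fin (a + a) × Fin (a + a)) ℂ)) :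
    ∃ (G' : Type) (_ : Fintype G') (C' : LabelledArithCircuit ℂ (Fin a × Fin a) Unit G'),
      C'.IsSymmetric (Perm (Fin a)) ∧ C'.eval (C'.output ()) = perPoly (Fin a) ℂ ∧
      Fintype.card G' ≤ Fintype.card G + (7 * (a + a) ^ 2 + 4) := by
  obtain ⟨G₁, _, C₁, h₁s, h₁e, h₁c⟩ :=
    exists_symmetric_aeval_retSubstFin (Matrix.of fun _ _ => (1 : ℂ)) ones_invariant hC
  rw [he, aeval_retSubstFin_ones_gmf χ hχ] at h₁e
  -- the constant `c_a(χ)⁻¹` at a single (fixed) output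
  obtain ⟨G₂, _, C₂, h₂s, h₂e, h₂c⟩ :=
    LabelledArithCircuit.exists_constOutputs (K := ℂ) (Fin a × Fin a) (Γ := Perm (Fin a))
      (fun _ : Unit => (doublingSum χ)⁻¹) (fun _ _ => rfl)
  obtain ⟨G₃, _, C₃, h₃s, h₃l, h₃r, h₃c⟩ := LabelledArithCircuit.IsSymmetric.exists_pairing h₁s h₂s
  obtain ⟨G₄, _, C₄, h₄s, h₄e, h₄c⟩ := LabelledArithCircuit.IsSymmetric.exists_hadamard h₃s
  refine ⟨G₄, inferInstance, C₄, h₄s, ?_, ?_⟩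
  · rw [h₄e, h₃l, h₃r, h₁e, h₂e, mul_comm, ← mul_assoc, ← map_mul, inv_mul_cancel₀ hd, map_one,
      one_mul]
  · have hU : Fintype.card Unit = 1 := Fintype.card_unit
    rw [hU] at h₂c h₄c
    omega

end Doubling

end Summit.ValiantsHypothesis.ValiantsHypothesis.Theorems.TwistedDetRankSliceVBPFermionic

end
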